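import Summits.QuantumFields.YangMills.Theorems.BalabanUVNodesN21GappedTopReading13CoPHSignFree
import Summits.QuantumFields.YangMills.Theorems.BalabanUVNodesK3V6Defs
import Summits.QuantumFields.YangMills.Theorems.BalabanUVNodesN20OffLiveOneTermReading

/-!
# N21 (NE7c) · THE K3⁸ KNIT ON THE GAPPED ROAD, BY NAME — a spine reading PINNED to the gapped top-lettered reading `crGap₁₃V` on the live-selector line and to the
# one-term reading `crOneTerm₁₃ 0` off it has its N21 face `KeyedShellWeight` AND its N27x face `KeyedExtractionV` as THEOREMS; the route decl K3⁸ then follows from the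
# K4 rates + N20 at the gapped carriers + N19′ at the gapped cores by `K3V6Defs.spineGivenEndpointR13SepCoPHV_of_facesV`

R134 seat `pub-ymgap-dag-n21-d` (g12, lane owner N21), node N21 = NE7c (NOT PRINTED; NOT proved at print's fixed thresholds), strategy s2 (by-name knit at the record);
key K3⁸ `SpineGivenEndpointR13SepCoPHV` = stmt-QuantumFields-27366 (dag-lead KEY MAP v2), filed `--kind proof --supports stmt-QuantumFields-27366 --as helper`; COUNT-NEUTRAL.
Theorems only (0 `def`).  Imports BY NAME: this seat's U8b `…N21GappedTopReading13CoPHSignFree` (p626047: `shellWeightBound_crGap₁₃VAt'`) and through it U5∕U6 (the reading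
`crGap₁₃V ∕ crGap₁₃VAt`, `sum_classSet₁₃_gapWeight{A,B}₁₃_eq_schemeZ`, the transfers `relWeightBound_crGap₁₃VAt`, `core_crGap₁₃VAt`); dag-n27-w1's tree mirror of the plan's
K3 skeleton v6 texts `…K3V6Defs` (p625739: `KeyedRatesHolderD4V`, `KeyedCoreEdgeHolderD4V`, `KeyedExtractionV ∕ …BFree`, `keyedExtractionV_of_bFree`,
`spineGivenEndpointR13SepCoPHV_of_facesV`; through it `K3V5Defs`: `SpineReading`, `RateReadingFn`, `CutReading`, `KeyedRelWeight`, `KeyedShellWeight`, `LiveSel`, `PHolderD4`);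
dag-n20-w1's `…N20OffLiveOneTermReading` (`crOneTerm₁₃`, `shellWeightBound_∕relWeightBound_∕extraction_crOneTerm₁₃`, `h19_shape_crOneTerm₁₃_of_target`).
[III] = [Balaban1988Convergent], [LF-I] = [Balaban1989LargeFieldI].

WHY.  The registered skeleton v6 (plan g85, b4e55110ab73e679) asks stub 2 for `∃ jc sh cr, PinnedAtLive jc sh cr ∧ KeyedRelWeight cr ∧ KeyedShellWeight cr ∧ KeyedExtractionV cr ∧
KeyedCoreEdgeHolderD4V β cr rr`, the pin naming dag-n20-d's reading of record `crOfRecord₁₃V jc sh` (print's `ε`-cut terms, where N21 ⟸ (M1), NOT PRINTED).  The composition onto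
the route decl does NOT read the pin (`obtain ⟨_jc, _sh, cr, -, …⟩`; tree form `K3V6Defs.spineGivenEndpointR13SepCoPHV_of_facesV`): K3⁸ follows from the FIVE FACES at ANY ONE
spine reading.  On this seat's gapped road (U1–U8: the top step's (2.17)∕(3.2) indicator factors re-lettered at a SELECTED common relative letter `ε(1−ρ_K)^{i⋆+1}` with the
two-sided collar `(ε(1−ρ_K)^{i⋆+2}, ε(1−ρ_K)^{i⋆})`, [LF-I] p.181's licence «we change the regularity conditions by a factor») the N21 face is a THEOREM, (M1)-FREE
(`shellWeightBound_crGap₁₃VAt'`), and so is the N27x face (E1∕E2 at the gapped carriers).  THIS FILE spells the reading that carries them into the item: `cr` PINNED to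
`crGap₁₃V 2 (jc F θ hP g₀ os) ρ n` ON the live-selector line `LiveSel F θ` (where the record's own selector makes E1∕E2 theorems) and to dag-n20-w1's one-term reading
`crOneTerm₁₃ 0` OFF it (the N27 lineage's declared off-live device: there N20∕N21∕N27x hold outright and N19′ is node U5's Target at the datum), and proves: the N21 and N27x
faces of `cr` OUTRIGHT modulo the displayed rows; the N20 and N19′ faces of `cr` from WITNESSES at the gapped carriers ∕ cores on the live line (+ the Target off it); and K3⁸
from K4 + those two.  §1 is READING-GENERIC in the live reading `crL` (dag-n21-w7's pair reading `crGap2₁₃V`, once landed with its faces, instantiates by one application).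

WHAT IS PROVED (kernel; [bookkeeping] throughout — pure logic over the named faces; NO estimate).
§1 (generic live pin `hon ∕ hoff`) `keyedShellWeight_of_livePin` · `keyedRelWeight_of_livePin` · `keyedExtractionBFree_of_livePin` · `keyedExtractionV_of_livePin` ·
  `keyedCoreEdgeHolderD4V_of_livePin` · `exists_reading_livePin` (the pin pair is inhabited: `if LiveSel then crL else crOneTerm₁₃ 0`) · ★★ `spineGivenEndpointR13SepCoPHV_of_livePin`.
§2 (the gapped instance `crL := crGap₁₃V 2 (jc …) ρ n`) ★★★ `keyedShellWeight_of_gapPin` (N21's v6 face on the pinned reading = THEOREM; rows: (H-ζ) on the live line, `0 ≤ ρ ≤ 1`,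
  `Σ 1∕(n+1) < ∞`) · ★★ `keyedExtractionBFree_of_gapPin` ∕ `keyedExtractionV_of_gapPin` (N27x's v6 face = THEOREM; row (H-ζ)) · `keyedRelWeight_of_gapPin_of_witness` ·
  `keyedCoreEdgeHolderD4V_of_gapPin_of_witness` · ★★★ `spineGivenEndpointR13SepCoPHV_of_gapPin` (K3⁸ from K4 + `KeyedRelWeight cr` + `KeyedCoreEdgeHolderD4V β cr rr` at the pinned
  reading — N21 + N27x DISCHARGED) · ★★★ `spineGivenEndpointR13SepCoPHV_of_gapRoad` (PIN-FREE: K3⁸ from K4, N20's WITNESS at the gapped carriers on the live line, N19′'s WITNESS at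
  the gapped cores on the live line (slot-keyed, under the crux's prefix and `PHolderD4 β`), node U5's Target off the live line, (H-ζ), the dial rows) · ★★
  `exists_gapPinned_faces` (what stub 2 would read under a gap pin: a reading so pinned carrying ALL FOUR K5 faces, N21's and N27x's by theorem).

HONEST FRAMING (binding).  Bookkeeping BY NAME; NO estimate of Bałaban's asserted or used; NE7c at print's FIXED thresholds NOT PRINTED ∕ NOT proved ((M1) stands there); the
discharged N21 face is (M1)-FREE for the top step's (2.17)∕(3.2) indicator family at a SELECTED common relative letter — the (3.3) family (dag-n21-w7's pair reading) and the
recent levels below the top stay LOCATED (cell census `t4/T4-XREAD-U5X15.md` A1∕A6∕A7); the off-live one-term pin + Target row is the N27 lineage's declared device, not content;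
K4, N20, N19′ (and node U5's Target) remain HYPOTHESES inhabited for no family today (K0⁷ `Record13SepCoPHInhabited` OPEN); this is NOT `stub_expansion13HV` (its `PinnedAtLive`
names `crOfRecord₁₃V` — the plan's decision, untouched and unread here); N21 NOT discharged; K3⁸ NOT claimed; counts UNMOVED (typed 28∕28 · discharged 5∕27); never a count claim.
No `sorry`, no `def`, no `instance`, no `notation`; standard axioms.  One finite four-torus programme at fixed `ε` — NOT ℝ⁴, NOT OS, NOT a mass gap, NOT the Clay problem.
-/

set_option autoImplicit false

noncomputable section

open scoped BigOperators

namespace Summit.QuantumFields.YangMills.Theorems.N21GappedRoadK3V6Knit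

open Literature.MathematicalPhysics.QuantumFieldTheory.Balaban1983to89
open Literature.MathematicalPhysics.QuantumFieldTheory.Balaban1983to89.T4Continuum
open Literature.MathematicalPhysics.QuantumFieldTheory.Balaban1983to89.Node00
open T4WeightBudget (RelWeightBound)
open T4IndicatorShell (ShellWeightBound)
open T4ContinuumYM4Torus (ForSmallCouplings)
open Summit.QuantumFields.BalabanUV.T4Continuum.Spine
open YMDAG.UVSplit (SpineReading₁₃CoPH classSet₁₃ badClass₁₃)
open Summit.QuantumFields.YangMills.BalabanUVNodes.SpineCanonicalWeights (core_nonneg_of_shellWeightBound)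
open Summit.QuantumFields.YangMills.Theorems.K3V5Defs (SpineReading RateReadingFn CutReading KeyedRelWeight KeyedShellWeight LiveSel PHolderD4)
open Summit.QuantumFields.YangMills.Theorems.K3V6Defs (KeyedRatesHolderD4V KeyedCoreEdgeHolderD4V KeyedExtractionV KeyedExtractionBFree keyedExtractionV_of_bFree
  spineGivenEndpointR13SepCoPHV_of_facesV)
open Summit.QuantumFields.YangMills.BalabanUVNodes.N20OffLiveOneTermReading (crOneTerm₁₃ shellWeightBound_crOneTerm₁₃ relWeightBound_crOneTerm₁₃ extraction_crOneTerm₁₃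
  h19_shape_crOneTerm₁₃_of_target)
open Summit.QuantumFields.YangMills.Theorems.N21ShellSplitOfRecord13CoPH (WidthLetter₁₃CoPH DepthLetter₁₃CoPH crGap₁₃V crGap₁₃VAt gapWeightA₁₃ gapWeightB₁₃ gapShellA₁₃
  gapShellB₁₃ gapCoreA₁₃ gapCoreB₁₃ shellWeightBound_crGap₁₃VAt' shellWeightBound_carriersGap₁₃' sum_classSet₁₃_gapWeightA₁₃_eq_schemeZ sum_classSet₁₃_gapWeightB₁₃_eq_schemeZ
  relWeightBound_crGap₁₃VAt core_crGap₁₃VAt gapWeightA₁₃_sub_gapShellA₁₃ gapWeightB₁₃_sub_gapShellB₁₃)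

/-! ## §1 A spine reading pinned to a live reading `crL` on the live-selector line and to the one-term reading off it: its faces -/

section LivePin

variable {crL cr : SpineReading}
  (hon : ∀ (F : T4Family) (θ : Stage13HParams F 2) (hP : θ.Provisos₁₃CoPH F 2) (g₀ : ℕ → ℝ) (os : List (ULoop F)), LiveSel F θ → cr F θ hP g₀ os = crL F θ hP g₀ os)
  (hoff : ∀ (F : T4Family) (θ : Stage13HParams F 2) (hP : θ.Provisos₁₃CoPH F 2) (g₀ : ℕ → ℝ) (os : List (ULoop F)), ¬ LiveSel F θ → cr F θ hP g₀ os = crOneTerm₁₃ 0 F θ hP g₀ os)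
include hon hoff

/-- **N21's face on a live-pinned reading**: `ShellWeightBound` at the live reading `crL` on the guarded admissible tuples OF THE LIVE LINE gives `KeyedShellWeight cr` — off the
line the one-term reading's shells are `0` (`shellWeightBound_crOneTerm₁₃`, outright). [bookkeeping] -/
theorem keyedShellWeight_of_livePin
    (hshell : ∀ (F : T4Family) (θ : Stage13HParams F 2) (hP : θ.Provisos₁₃CoPH F 2), ((θ.ZhUnity F 2 ∧ θ.SlotsNondegenerate₁₃ F 2) ∧ LiveSel F θ) → θ.Admissible F 2 →
      ∀ (g₀ : ℕ → ℝ) (os : List (ULoop F)),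
        ShellWeightBound (crL F θ hP g₀ os).l₀ (crL F θ hP g₀ os).T (crL F θ hP g₀ os).A (crL F θ hP g₀ os).B (crL F θ hP g₀ os).shA (crL F θ hP g₀ os).shB
          (crL F θ hP g₀ os).Wsh) :
    KeyedShellWeight cr := by
  intro F θ hP hG hθ g₀ os
  by_cases hs : LiveSel F θ
  · rw [hon F θ hP g₀ os hs]
    exact hshell F θ hP ⟨hG, hs⟩ hθ g₀ os
  · rw [hoff F θ hP g₀ os hs]
    exact shellWeightBound_crOneTerm₁₃ 0 θ hP g₀ os

/-- **N20's face on a live-pinned reading**: `RelWeightBound` at `crL` on the live line gives `KeyedRelWeight cr` (off the line the one-term bad class is empty,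
`relWeightBound_crOneTerm₁₃`). [bookkeeping] -/
theorem keyedRelWeight_of_livePin
    (hrel : ∀ (F : T4Family) (θ : Stage13HParams F 2) (hP : θ.Provisos₁₃CoPH F 2), ((θ.ZhUnity F 2 ∧ θ.SlotsNondegenerate₁₃ F 2) ∧ LiveSel F θ) → θ.Admissible F 2 →
      ∀ (g₀ : ℕ → ℝ) (os : List (ULoop F)),
        RelWeightBound (crL F θ hP g₀ os).l₀ (crL F θ hP g₀ os).T (crL F θ hP g₀ os).A (crL F θ hP g₀ os).B (crL F θ hP g₀ os).Bad (crL F θ hP g₀ os).W) :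
    KeyedRelWeight cr := by
  intro F θ hP hG hθ g₀ os
  by_cases hs : LiveSel F θ
  · rw [hon F θ hP g₀ os hs]
    exact hrel F θ hP ⟨hG, hs⟩ hθ g₀ os
  · rw [hoff F θ hP g₀ os hs]
    exact relWeightBound_crOneTerm₁₃ 0 θ hP g₀ os

/-- **N27x's (B)-free face on a live-pinned reading**: the extraction identities at `crL` on the live line (under `ForSmallCouplings`, (B)∕END unread) give
`KeyedExtractionBFree cr` — off the line E1∕E2 at the one-term reading hold at every tuple and every `g₀` (`extraction_crOneTerm₁₃`). [bookkeeping] -/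
theorem keyedExtractionBFree_of_livePin
    (hext : ∀ (F : T4Family) (θ : Stage13HParams F 2) (hP : θ.Provisos₁₃CoPH F 2), ((θ.ZhUnity F 2 ∧ θ.SlotsNondegenerate₁₃ F 2) ∧ LiveSel F θ) → θ.Admissible F 2 →
      ForSmallCouplings (datumOfRecord₁₃CoPH F 2 θ hP) fun g₀ => ∀ os : List (ULoop F),
        0 < (crL F θ hP g₀ os).l₀ ∧ 0 < (crL F θ hP g₀ os).vol ∧
        (∀ (K : ℕ) (t : ℝ), |t| ≤ (crL F θ hP g₀ os).l₀ →
          T4GenFunBounds.schemeZ ((datumOfRecord₁₃CoPH F 2 θ hP).scheme g₀) os ((crL F θ hP g₀ os).K₀ + K) t =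
            ∑ τ ∈ (crL F θ hP g₀ os).T K, (crL F θ hP g₀ os).A K t τ) ∧
        (∀ (K : ℕ) (t : ℝ), |t| ≤ (crL F θ hP g₀ os).l₀ →
          T4GenFunBounds.schemeZ ((datumOfRecord₁₃CoPH F 2 θ hP).scheme g₀) os ((crL F θ hP g₀ os).K₀ + K + 1) t =
            ∑ τ ∈ (crL F θ hP g₀ os).T K, (crL F θ hP g₀ os).B K t τ)) :
    KeyedExtractionBFree cr := by
  intro F θ hP hG hθ
  by_cases hs : LiveSel F θ
  · refine ForSmallCouplings.mono (fun g₀ h os => ?_) (hext F θ hP ⟨hG, hs⟩ hθ)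
    rw [hon F θ hP g₀ os hs]
    exact h os
  · exact ForSmallCouplings.of_forall fun g₀ os => by
      rw [hoff F θ hP g₀ os hs]
      exact extraction_crOneTerm₁₃ 0 θ hP g₀ os

/-- … hence the slot-keyed v6 face `KeyedExtractionV cr` (`K3V6Defs.keyedExtractionV_of_bFree`: the slot datum's partition functions are the record's). [bookkeeping] -/
theorem keyedExtractionV_of_livePin
    (hext : ∀ (F : T4Family) (θ : Stage13HParams F 2) (hP : θ.Provisos₁₃CoPH F 2), ((θ.ZhUnity F 2 ∧ θ.SlotsNondegenerate₁₃ F 2) ∧ LiveSel F θ) → θ.Admissible F 2 →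
      ForSmallCouplings (datumOfRecord₁₃CoPH F 2 θ hP) fun g₀ => ∀ os : List (ULoop F),
        0 < (crL F θ hP g₀ os).l₀ ∧ 0 < (crL F θ hP g₀ os).vol ∧
        (∀ (K : ℕ) (t : ℝ), |t| ≤ (crL F θ hP g₀ os).l₀ →
          T4GenFunBounds.schemeZ ((datumOfRecord₁₃CoPH F 2 θ hP).scheme g₀) os ((crL F θ hP g₀ os).K₀ + K) t =
            ∑ τ ∈ (crL F θ hP g₀ os).T K, (crL F θ hP g₀ os).A K t τ) ∧
        (∀ (K : ℕ) (t : ℝ), |t| ≤ (crL F θ hP g₀ os).l₀ →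
          T4GenFunBounds.schemeZ ((datumOfRecord₁₃CoPH F 2 θ hP).scheme g₀) os ((crL F θ hP g₀ os).K₀ + K + 1) t =
            ∑ τ ∈ (crL F θ hP g₀ os).T K, (crL F θ hP g₀ os).B K t τ)) :
    KeyedExtractionV cr :=
  keyedExtractionV_of_bFree (keyedExtractionBFree_of_livePin hon hoff hext)

/-- **N19′'s slot-keyed face on a live-pinned reading**: the core edge at `crL` on the live line, in the v6 shape (slot `v`, prefix (B) → END, `ForSmallCouplings` at the slot
datum, `PHolderD4 β` at the rate reading), AND node U5's Target at the datum off the line (dag-n20-w1's `h19_shape_crOneTerm₁₃_of_target`), give `KeyedCoreEdgeHolderD4V β cr rr`.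
[bookkeeping] -/
theorem keyedCoreEdgeHolderD4V_of_livePin (β : ℝ) (rr : RateReadingFn)
    (h19on : ∀ (F : T4Family) (θ : Stage13HParams F 2) (h : θ.Provisos₁₃SepCoPH F 2) (v : Revision₁₃ F 2 θ h),
      ((θ.ZhUnity F 2 ∧ θ.SlotsNondegenerate₁₃ F 2) ∧ LiveSel F θ) → θ.Admissible F 2 →
      B16.EndStatementBPrinted (datumOfRecord₁₃SepCoPHV F 2 θ h v).C → DagBinding.EndpointExistence (datumOfRecord₁₃SepCoPHV F 2 θ h v).C.toB12 →
        ForSmallCouplings (datumOfRecord₁₃SepCoPHV F 2 θ h v) fun g₀ => ∀ os : List (ULoop F),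
          PHolderD4 β (datumOfRecord₁₃SepCoPHV F 2 θ h v) (rr F θ h.toCore g₀ os) → letI := (crL F θ h.toCore g₀ os).dec
            ∃ δ : ℕ → ℝ, NE7.Core (crL F θ h.toCore g₀ os).l₀ (crL F θ h.toCore g₀ os).vol (crL F θ h.toCore g₀ os).T (crL F θ h.toCore g₀ os).Bad
              (fun K t τ => (crL F θ h.toCore g₀ os).A K t τ - (crL F θ h.toCore g₀ os).shA K t τ)
              (fun K t τ => (crL F θ h.toCore g₀ os).B K t τ - (crL F θ h.toCore g₀ os).shB K t τ) δ ∧ Summable δ)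
    (h19off : ∀ (F : T4Family) (θ : Stage13HParams F 2) (hP : θ.Provisos₁₃CoPH F 2), ((θ.ZhUnity F 2 ∧ θ.SlotsNondegenerate₁₃ F 2) ∧ ¬ LiveSel F θ) → θ.Admissible F 2 →
      ∀ (g₀ : ℕ → ℝ) (os : List (ULoop F)), PHolderD4 β (datumOfRecord₁₃CoPH F 2 θ hP) (rr F θ hP g₀ os) →
        ∃ δ : ℕ → ℝ, NE7.Target ((F.side : ℝ) ^ 4) 1 δ (fun K => T4GenFunBounds.schemeZ ((datumOfRecord₁₃CoPH F 2 θ hP).scheme g₀) os (0 + K))) :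
    KeyedCoreEdgeHolderD4V β cr rr := by
  intro F θ h v hG hθ hB hE
  by_cases hs : LiveSel F θ
  · refine ForSmallCouplings.mono (fun g₀ h' os hPr => ?_) (h19on F θ h v ⟨hG, hs⟩ hθ hB hE)
    rw [hon F θ h.toCore g₀ os hs]
    exact h' os hPr
  · exact ForSmallCouplings.of_forall fun g₀ os hPr => by
      rw [hoff F θ h.toCore g₀ os hs]
      exact h19_shape_crOneTerm₁₃_of_target 0 rr (PHolderD4 β) h19off F θ h.toCore ⟨hG, hs⟩ hθ g₀ os hPr

omit hon hoff in
/-- **The pin pair is inhabited**: the reading `if LiveSel F θ then crL … else crOneTerm₁₃ 0 …` (classical case split on the selector line). [bookkeeping] -/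
theorem exists_reading_livePin (crL : SpineReading) :
    ∃ cr : SpineReading,
      (∀ (F : T4Family) (θ : Stage13HParams F 2) (hP : θ.Provisos₁₃CoPH F 2) (g₀ : ℕ → ℝ) (os : List (ULoop F)), LiveSel F θ → cr F θ hP g₀ os = crL F θ hP g₀ os) ∧
      (∀ (F : T4Family) (θ : Stage13HParams F 2) (hP : θ.Provisos₁₃CoPH F 2) (g₀ : ℕ → ℝ) (os : List (ULoop F)),
        ¬ LiveSel F θ → cr F θ hP g₀ os = crOneTerm₁₃ 0 F θ hP g₀ os) := by
  classical
  exact ⟨fun F θ hP g₀ os => if LiveSel F θ then crL F θ hP g₀ os else crOneTerm₁₃ 0 F θ hP g₀ os,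
    fun F θ hP g₀ os hs => if_pos hs, fun F θ hP g₀ os hs => if_neg hs⟩

/-- ★★ **K3⁸ FROM A LIVE-PINNED READING**: with N21's and N27x's faces supplied AT THE LIVE READING on the live line (`hshell`, `hext`), the route decl follows from K4
`KeyedRatesHolderD4V β rr`, N20 `KeyedRelWeight cr` and N19′ `KeyedCoreEdgeHolderD4V β cr rr` (`K3V6Defs.spineGivenEndpointR13SepCoPHV_of_facesV`).  Every face a HYPOTHESIS
except what `hshell ∕ hext` supply. [bookkeeping] -/
theorem spineGivenEndpointR13SepCoPHV_of_livePin (β : ℝ) (rr : RateReadingFn)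
    (hshell : ∀ (F : T4Family) (θ : Stage13HParams F 2) (hP : θ.Provisos₁₃CoPH F 2), ((θ.ZhUnity F 2 ∧ θ.SlotsNondegenerate₁₃ F 2) ∧ LiveSel F θ) → θ.Admissible F 2 →
      ∀ (g₀ : ℕ → ℝ) (os : List (ULoop F)),
        ShellWeightBound (crL F θ hP g₀ os).l₀ (crL F θ hP g₀ os).T (crL F θ hP g₀ os).A (crL F θ hP g₀ os).B (crL F θ hP g₀ os).shA (crL F θ hP g₀ os).shB
          (crL F θ hP g₀ os).Wsh)
    (hext : ∀ (F : T4Family) (θ : Stage13HParams F 2) (hP : θ.Provisos₁₃CoPH F 2), ((θ.ZhUnity F 2 ∧ θ.SlotsNondegenerate₁₃ F 2) ∧ LiveSel F θ) → θ.Admissible F 2 →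
      ForSmallCouplings (datumOfRecord₁₃CoPH F 2 θ hP) fun g₀ => ∀ os : List (ULoop F),
        0 < (crL F θ hP g₀ os).l₀ ∧ 0 < (crL F θ hP g₀ os).vol ∧
        (∀ (K : ℕ) (t : ℝ), |t| ≤ (crL F θ hP g₀ os).l₀ →
          T4GenFunBounds.schemeZ ((datumOfRecord₁₃CoPH F 2 θ hP).scheme g₀) os ((crL F θ hP g₀ os).K₀ + K) t =
            ∑ τ ∈ (crL F θ hP g₀ os).T K, (crL F θ hP g₀ os).A K t τ) ∧
        (∀ (K : ℕ) (t : ℝ), |t| ≤ (crL F θ hP g₀ os).l₀ →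
          T4GenFunBounds.schemeZ ((datumOfRecord₁₃CoPH F 2 θ hP).scheme g₀) os ((crL F θ hP g₀ os).K₀ + K + 1) t =
            ∑ τ ∈ (crL F θ hP g₀ os).T K, (crL F θ hP g₀ os).B K t τ))
    (h20 : KeyedRelWeight cr) (hr : KeyedRatesHolderD4V β rr) (h19 : KeyedCoreEdgeHolderD4V β cr rr) :
    Summit.QuantumFields.YangMills.Theses.BalabanUVNodes.SpineGivenEndpointR13SepCoPHV :=
  spineGivenEndpointR13SepCoPHV_of_facesV β cr rr h20 (keyedShellWeight_of_livePin hon hoff hshell) hr h19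
    (keyedExtractionV_of_livePin hon hoff hext)

end LivePin

/-! ## §2 The gapped road: `crL := crGap₁₃V 2 (jc …) ρ n` — N21 and N27x are THEOREMS on the pinned reading; K3⁸ from K4 + N20 + N19′ at the gapped objects -/

section GapPin

variable (jc : CutReading) (ρ : WidthLetter₁₃CoPH 2) (n : DepthLetter₁₃CoPH 2) {cr : SpineReading}
  (hon : ∀ (F : T4Family) (θ : Stage13HParams F 2) (hP : θ.Provisos₁₃CoPH F 2) (g₀ : ℕ → ℝ) (os : List (ULoop F)),
    LiveSel F θ → cr F θ hP g₀ os = crGap₁₃V 2 (jc F θ hP g₀ os) ρ n F θ hP g₀ os)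
  (hoff : ∀ (F : T4Family) (θ : Stage13HParams F 2) (hP : θ.Provisos₁₃CoPH F 2) (g₀ : ℕ → ℝ) (os : List (ULoop F)), ¬ LiveSel F θ → cr F θ hP g₀ os = crOneTerm₁₃ 0 F θ hP g₀ os)
  (hζm : ∀ (F : T4Family) (θ : Stage13HParams F 2), θ.Provisos₁₃CoPH F 2 → ((θ.ZhUnity F 2 ∧ θ.SlotsNondegenerate₁₃ F 2) ∧ LiveSel F θ) → θ.Admissible F 2 →
    ZetaMeasurable F 2 θ.ζ)
include hon hoff hζm

/-- ★★★ **N21's v6 FACE ON THE GAP-PINNED READING IS A THEOREM** — `KeyedShellWeight cr` for `cr` pinned to `crGap₁₃V 2 (jc …) ρ n` on the live line and to `crOneTerm₁₃ 0` off it;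
rows: (H-ζ) `ZetaMeasurable F 2 θ.ζ` on the guarded admissible tuples of the live line, the dial rows `0 ≤ ρ ≤ 1` and `Σ_K 1∕(n_K+1) < ∞`.  (M1)-FREE, SIGN-FREE (U8b
`shellWeightBound_crGap₁₃VAt'`: two-sided collar shells at a selected common depth, pigeonhole `4(2L^m)⁴∕(n_K+1)`); NO estimate of Bałaban's. [bookkeeping] -/
theorem keyedShellWeight_of_gapPin (hρ : ∀ (F : T4Family) (θ : Stage13HParams F 2) (hP : θ.Provisos₁₃CoPH F 2) (g₀ : ℕ → ℝ) (os : List (ULoop F)) (K : ℕ),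
      0 ≤ ρ F θ hP g₀ os K ∧ ρ F θ hP g₀ os K ≤ 1)
    (hn : ∀ (F : T4Family) (θ : Stage13HParams F 2) (hP : θ.Provisos₁₃CoPH F 2) (g₀ : ℕ → ℝ) (os : List (ULoop F)),
      Summable (fun K => 1 / ((n F θ hP g₀ os K : ℝ) + 1))) :
    KeyedShellWeight cr :=
  keyedShellWeight_of_livePin hon hoff fun F θ hP hG hθ g₀ os =>
    shellWeightBound_crGap₁₃VAt' 0 (jc F θ hP g₀ os) ρ n θ hP g₀ os (EOfRecord₁₃ F 2 θ.toStage13Params) hG.2 (hζm F θ hP hG hθ)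
      (fun K => (hρ F θ hP g₀ os K).1) (fun K => (hρ F θ hP g₀ os K).2) (hn F θ hP g₀ os)

/-- ★★ **N27x's (B)-FREE FACE ON THE GAP-PINNED READING IS A THEOREM** — E1∕E2 at the gapped carriers for EVERY `g₀` on the live line (U6 `sum_classSet₁₃_gapWeight{A,B}₁₃_eq_schemeZ`;
row (H-ζ)), outright off it. [bookkeeping] -/
theorem keyedExtractionBFree_of_gapPin : KeyedExtractionBFree cr :=
  keyedExtractionBFree_of_livePin hon hoff fun F θ hP hG hθ =>
    ForSmallCouplings.of_forall fun g₀ os =>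
      ⟨one_pos, pow_pos F.side_pos 4,
        fun K t _ => (sum_classSet₁₃_gapWeightA₁₃_eq_schemeZ 0 θ hP g₀ os (EOfRecord₁₃ F 2 θ.toStage13Params) hG.2 (hζm F θ hP hG hθ) _ _ K t).symm,
        fun K t _ => (sum_classSet₁₃_gapWeightB₁₃_eq_schemeZ 0 θ hP g₀ os (EOfRecord₁₃ F 2 θ.toStage13Params) hG.2 (hζm F θ hP hG hθ) _ _ K t).symm⟩

/-- ★★ … and **N27x's slot-keyed v6 FACE** `KeyedExtractionV cr` (transfer `keyedExtractionV_of_bFree`). [bookkeeping] -/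
theorem keyedExtractionV_of_gapPin : KeyedExtractionV cr :=
  keyedExtractionV_of_bFree (keyedExtractionBFree_of_gapPin jc ρ n hon hoff hζm)

omit hζm in
/-- **N20's face on the gap-pinned reading FROM A WITNESS at the gapped carriers** on the live line (`∃ W, RelWeightBound 1 (classSet₁₃ θ 0 g₀) (gapWeightA₁₃ …) (gapWeightB₁₃ …)
(badClass₁₃ θ 0 g₀ (jc …)) W`; U6 transfer `relWeightBound_crGap₁₃VAt` to the reading's canonical `W`); outright off the line.  N20's witness is a HYPOTHESIS. [bookkeeping] -/
theorem keyedRelWeight_of_gapPin_of_witness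
    (h20 : ∀ (F : T4Family) (θ : Stage13HParams F 2) (hP : θ.Provisos₁₃CoPH F 2), ((θ.ZhUnity F 2 ∧ θ.SlotsNondegenerate₁₃ F 2) ∧ LiveSel F θ) → θ.Admissible F 2 →
      ∀ (g₀ : ℕ → ℝ) (os : List (ULoop F)),
        ∃ W : ℕ → ℝ, RelWeightBound 1 (classSet₁₃ θ 0 g₀) (gapWeightA₁₃ θ hP 0 g₀ os (ρ F θ hP g₀ os) (n F θ hP g₀ os))
          (gapWeightB₁₃ θ hP 0 g₀ os (ρ F θ hP g₀ os) (n F θ hP g₀ os)) (badClass₁₃ θ 0 g₀ (jc F θ hP g₀ os)) W) :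
    KeyedRelWeight cr :=
  keyedRelWeight_of_livePin hon hoff fun F θ hP hG hθ g₀ os => by
    obtain ⟨W, hW⟩ := h20 F θ hP hG hθ g₀ os
    exact relWeightBound_crGap₁₃VAt 0 (jc F θ hP g₀ os) ρ n θ hP g₀ os hW

/-- **N19′'s slot-keyed face on the gap-pinned reading FROM A WITNESS at the gapped cores** on the live line — in the v6 shape (slot `v`, prefix, `ForSmallCouplings` at the slot
datum, `PHolderD4 β`): `∃ δ, NE7.Core 1 (F.side^4) (classSet₁₃ θ 0 g₀) (badClass₁₃ θ 0 g₀ (jc …)) (gapCoreA₁₃ …) (gapCoreB₁₃ …) δ ∧ Summable δ` (U6 transfer `core_crGap₁₃VAt` to the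
canonical rate; core non-negativity from the PROVED N21 face, `core_nonneg_of_shellWeightBound`) — AND node U5's Target at the datum off the line.  Both HYPOTHESES; NE7 NOT PRINTED
for `d = 4`. [bookkeeping] -/
theorem keyedCoreEdgeHolderD4V_of_gapPin_of_witness (β : ℝ) (rr : RateReadingFn)
    (hρ : ∀ (F : T4Family) (θ : Stage13HParams F 2) (hP : θ.Provisos₁₃CoPH F 2) (g₀ : ℕ → ℝ) (os : List (ULoop F)) (K : ℕ),
      0 ≤ ρ F θ hP g₀ os K ∧ ρ F θ hP g₀ os K ≤ 1)
    (hn : ∀ (F : T4Family) (θ : Stage13HParams F 2) (hP : θ.Provisos₁₃CoPH F 2) (g₀ : ℕ → ℝ) (os : List (ULoop F)),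
      Summable (fun K => 1 / ((n F θ hP g₀ os K : ℝ) + 1)))
    (h19on : ∀ (F : T4Family) (θ : Stage13HParams F 2) (h : θ.Provisos₁₃SepCoPH F 2) (v : Revision₁₃ F 2 θ h),
      ((θ.ZhUnity F 2 ∧ θ.SlotsNondegenerate₁₃ F 2) ∧ LiveSel F θ) → θ.Admissible F 2 →
      B16.EndStatementBPrinted (datumOfRecord₁₃SepCoPHV F 2 θ h v).C → DagBinding.EndpointExistence (datumOfRecord₁₃SepCoPHV F 2 θ h v).C.toB12 →
        ForSmallCouplings (datumOfRecord₁₃SepCoPHV F 2 θ h v) fun g₀ => ∀ os : List (ULoop F),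
          PHolderD4 β (datumOfRecord₁₃SepCoPHV F 2 θ h v) (rr F θ h.toCore g₀ os) →
            letI : DecidableEq (Σ K, SiteSeqKey F (0 + K)) := Classical.decEq _
            ∃ δ : ℕ → ℝ, NE7.Core 1 (F.side ^ 4) (classSet₁₃ θ 0 g₀) (badClass₁₃ θ 0 g₀ (jc F θ h.toCore g₀ os))
              (gapCoreA₁₃ θ h.toCore 0 g₀ os (ρ F θ h.toCore g₀ os) (n F θ h.toCore g₀ os))
              (gapCoreB₁₃ θ h.toCore 0 g₀ os (ρ F θ h.toCore g₀ os) (n F θ h.toCore g₀ os)) δ ∧ Summable δ)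
    (h19off : ∀ (F : T4Family) (θ : Stage13HParams F 2) (hP : θ.Provisos₁₃CoPH F 2), ((θ.ZhUnity F 2 ∧ θ.SlotsNondegenerate₁₃ F 2) ∧ ¬ LiveSel F θ) → θ.Admissible F 2 →
      ∀ (g₀ : ℕ → ℝ) (os : List (ULoop F)), PHolderD4 β (datumOfRecord₁₃CoPH F 2 θ hP) (rr F θ hP g₀ os) →
        ∃ δ : ℕ → ℝ, NE7.Target ((F.side : ℝ) ^ 4) 1 δ (fun K => T4GenFunBounds.schemeZ ((datumOfRecord₁₃CoPH F 2 θ hP).scheme g₀) os (0 + K))) :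
    KeyedCoreEdgeHolderD4V β cr rr := by
  refine keyedCoreEdgeHolderD4V_of_livePin hon hoff β rr (fun F θ h v hG hθ hB hE => ?_) h19off
  refine ForSmallCouplings.mono (fun g₀ h' os hPr => ?_) (h19on F θ h v hG hθ hB hE)
  obtain ⟨δ, hδ, hsum⟩ := h' os hPr
  have hA : (fun K t x => gapWeightA₁₃ θ h.toCore 0 g₀ os (ρ F θ h.toCore g₀ os) (n F θ h.toCore g₀ os) K t x -
      gapShellA₁₃ θ h.toCore 0 g₀ os (ρ F θ h.toCore g₀ os) (n F θ h.toCore g₀ os) K t x) =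
      gapCoreA₁₃ θ h.toCore 0 g₀ os (ρ F θ h.toCore g₀ os) (n F θ h.toCore g₀ os) :=
    funext fun K => funext fun t => funext fun x => gapWeightA₁₃_sub_gapShellA₁₃ θ h.toCore 0 g₀ os _ _ K t x
  have hB' : (fun K t x => gapWeightB₁₃ θ h.toCore 0 g₀ os (ρ F θ h.toCore g₀ os) (n F θ h.toCore g₀ os) K t x -
      gapShellB₁₃ θ h.toCore 0 g₀ os (ρ F θ h.toCore g₀ os) (n F θ h.toCore g₀ os) K t x) =
      gapCoreB₁₃ θ h.toCore 0 g₀ os (ρ F θ h.toCore g₀ os) (n F θ h.toCore g₀ os) :=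
    funext fun K => funext fun t => funext fun x => gapWeightB₁₃_sub_gapShellB₁₃ θ h.toCore 0 g₀ os _ _ K t x
  have hsh := shellWeightBound_carriersGap₁₃' 0 θ h.toCore g₀ os (EOfRecord₁₃ F 2 θ.toStage13Params) hG.2 (hζm F θ h.toCore hG hθ)
    (fun K => (hρ F θ h.toCore g₀ os K).1) (fun K => (hρ F θ h.toCore g₀ os K).2) (hn F θ h.toCore g₀ os)
  letI : DecidableEq (Σ K, SiteSeqKey F (0 + K)) := Classical.decEq _
  have hP0 := core_nonneg_of_shellWeightBound (Bad := badClass₁₃ θ 0 g₀ (jc F θ h.toCore g₀ os)) hsh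
  exact ⟨_, core_crGap₁₃VAt 0 (jc F θ h.toCore g₀ os) ρ n θ h.toCore g₀ os hP0 (by rw [hA, hB']; exact hδ) hsum⟩

/-- ★★★ **K3⁸ ON THE GAPPED ROAD, AT THE PINNED READING — N21 AND N27x DISCHARGED BY NAME.**  For a spine reading `cr` pinned to `crGap₁₃V 2 (jc …) ρ n` on the live line and to
`crOneTerm₁₃ 0` off it: K4 `KeyedRatesHolderD4V β rr`, N20 `KeyedRelWeight cr` and N19′ `KeyedCoreEdgeHolderD4V β cr rr` (HYPOTHESES) give the route decl, the N21 and N27x faces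
being THEOREMS here (rows (H-ζ) on the live line + the dial rows).  NOT `stub_expansion13HV` (its `PinnedAtLive` names `crOfRecord₁₃V`); nothing of Bałaban's proved. [bookkeeping] -/
theorem spineGivenEndpointR13SepCoPHV_of_gapPin (β : ℝ) (rr : RateReadingFn)
    (hρ : ∀ (F : T4Family) (θ : Stage13HParams F 2) (hP : θ.Provisos₁₃CoPH F 2) (g₀ : ℕ → ℝ) (os : List (ULoop F)) (K : ℕ),
      0 ≤ ρ F θ hP g₀ os K ∧ ρ F θ hP g₀ os K ≤ 1)
    (hn : ∀ (F : T4Family) (θ : Stage13HParams F 2) (hP : θ.Provisos₁₃CoPH F 2) (g₀ : ℕ → ℝ) (os : List (ULoop F)),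
      Summable (fun K => 1 / ((n F θ hP g₀ os K : ℝ) + 1)))
    (h20 : KeyedRelWeight cr) (hr : KeyedRatesHolderD4V β rr) (h19 : KeyedCoreEdgeHolderD4V β cr rr) :
    Summit.QuantumFields.YangMills.Theses.BalabanUVNodes.SpineGivenEndpointR13SepCoPHV :=
  spineGivenEndpointR13SepCoPHV_of_facesV β cr rr h20 (keyedShellWeight_of_gapPin jc ρ n hon hoff hζm hρ hn) hr h19 (keyedExtractionV_of_gapPin jc ρ n hon hoff hζm)

end GapPin

/-! ## §3 Pin-free: K3⁸ from K4 + N20's and N19′'s WITNESSES at the gapped objects on the live line + node U5's Target off it -/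

section GapRoad

/-- ★★★ **K3⁸ ON THE GAPPED ROAD, PIN-FREE — N21 AND N27x DISCHARGED BY NAME.**  Displayed, binder by binder: (H-ζ) `ZetaMeasurable` on the guarded admissible tuples of the
live-selector line; the dial rows `0 ≤ ρ ≤ 1`, `Σ_K 1∕(n_K+1) < ∞` (dag-n21-w2's `…GappedTopCutDials.exists_dials_of_summable` produces such dials from a closeness letter); K4
`KeyedRatesHolderD4V β rr`; N20's WITNESS at the gapped carriers on the live line; N19′'s WITNESS at the gapped cores on the live line (slot-keyed, under (B) → END →
`ForSmallCouplings` at the slot datum and `PHolderD4 β`); node U5's Target at the datum off the live line.  The reading is minted inside the proof (`exists_reading_livePin`).  Every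
displayed binder is a HYPOTHESIS inhabited for no family today (K0⁷ OPEN); NE7 ∕ NE7b NOT PRINTED for `d = 4`; N21 NOT discharged by this; K3⁸ NOT claimed. [bookkeeping] -/
theorem spineGivenEndpointR13SepCoPHV_of_gapRoad (β : ℝ) (rr : RateReadingFn) (jc : CutReading) (ρ : WidthLetter₁₃CoPH 2) (n : DepthLetter₁₃CoPH 2)
    (hζm : ∀ (F : T4Family) (θ : Stage13HParams F 2), θ.Provisos₁₃CoPH F 2 → ((θ.ZhUnity F 2 ∧ θ.SlotsNondegenerate₁₃ F 2) ∧ LiveSel F θ) → θ.Admissible F 2 →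
      ZetaMeasurable F 2 θ.ζ)
    (hρ : ∀ (F : T4Family) (θ : Stage13HParams F 2) (hP : θ.Provisos₁₃CoPH F 2) (g₀ : ℕ → ℝ) (os : List (ULoop F)) (K : ℕ),
      0 ≤ ρ F θ hP g₀ os K ∧ ρ F θ hP g₀ os K ≤ 1)
    (hn : ∀ (F : T4Family) (θ : Stage13HParams F 2) (hP : θ.Provisos₁₃CoPH F 2) (g₀ : ℕ → ℝ) (os : List (ULoop F)),
      Summable (fun K => 1 / ((n F θ hP g₀ os K : ℝ) + 1)))
    (hr : KeyedRatesHolderD4V β rr)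
    (h20 : ∀ (F : T4Family) (θ : Stage13HParams F 2) (hP : θ.Provisos₁₃CoPH F 2), ((θ.ZhUnity F 2 ∧ θ.SlotsNondegenerate₁₃ F 2) ∧ LiveSel F θ) → θ.Admissible F 2 →
      ∀ (g₀ : ℕ → ℝ) (os : List (ULoop F)),
        ∃ W : ℕ → ℝ, RelWeightBound 1 (classSet₁₃ θ 0 g₀) (gapWeightA₁₃ θ hP 0 g₀ os (ρ F θ hP g₀ os) (n F θ hP g₀ os))
          (gapWeightB₁₃ θ hP 0 g₀ os (ρ F θ hP g₀ os) (n F θ hP g₀ os)) (badClass₁₃ θ 0 g₀ (jc F θ hP g₀ os)) W)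
    (h19 : ∀ (F : T4Family) (θ : Stage13HParams F 2) (h : θ.Provisos₁₃SepCoPH F 2) (v : Revision₁₃ F 2 θ h),
      ((θ.ZhUnity F 2 ∧ θ.SlotsNondegenerate₁₃ F 2) ∧ LiveSel F θ) → θ.Admissible F 2 →
      B16.EndStatementBPrinted (datumOfRecord₁₃SepCoPHV F 2 θ h v).C → DagBinding.EndpointExistence (datumOfRecord₁₃SepCoPHV F 2 θ h v).C.toB12 →
        ForSmallCouplings (datumOfRecord₁₃SepCoPHV F 2 θ h v) fun g₀ => ∀ os : List (ULoop F),
          PHolderD4 β (datumOfRecord₁₃SepCoPHV F 2 θ h v) (rr F θ h.toCore g₀ os) →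
            letI : DecidableEq (Σ K, SiteSeqKey F (0 + K)) := Classical.decEq _
            ∃ δ : ℕ → ℝ, NE7.Core 1 (F.side ^ 4) (classSet₁₃ θ 0 g₀) (badClass₁₃ θ 0 g₀ (jc F θ h.toCore g₀ os))
              (gapCoreA₁₃ θ h.toCore 0 g₀ os (ρ F θ h.toCore g₀ os) (n F θ h.toCore g₀ os))
              (gapCoreB₁₃ θ h.toCore 0 g₀ os (ρ F θ h.toCore g₀ os) (n F θ h.toCore g₀ os)) δ ∧ Summable δ)
    (htarget : ∀ (F : T4Family) (θ : Stage13HParams F 2) (hP : θ.Provisos₁₃CoPH F 2), ((θ.ZhUnity F 2 ∧ θ.SlotsNondegenerate₁₃ F 2) ∧ ¬ LiveSel F θ) → θ.Admissible F 2 →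
      ∀ (g₀ : ℕ → ℝ) (os : List (ULoop F)), PHolderD4 β (datumOfRecord₁₃CoPH F 2 θ hP) (rr F θ hP g₀ os) →
        ∃ δ : ℕ → ℝ, NE7.Target ((F.side : ℝ) ^ 4) 1 δ (fun K => T4GenFunBounds.schemeZ ((datumOfRecord₁₃CoPH F 2 θ hP).scheme g₀) os (0 + K))) :
    Summit.QuantumFields.YangMills.Theses.BalabanUVNodes.SpineGivenEndpointR13SepCoPHV := by
  obtain ⟨cr, hon, hoff⟩ := exists_reading_livePin (fun F θ hP g₀ os => crGap₁₃V 2 (jc F θ hP g₀ os) ρ n F θ hP g₀ os)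
  exact spineGivenEndpointR13SepCoPHV_of_gapPin jc ρ n hon hoff hζm β rr hρ hn (keyedRelWeight_of_gapPin_of_witness jc ρ n hon hoff h20) hr
    (keyedCoreEdgeHolderD4V_of_gapPin_of_witness jc ρ n hon hoff hζm β rr hρ hn h19 htarget)

/-- ★★ **WHAT STUB 2 WOULD READ UNDER A GAP PIN** (the v6 text's conclusion with `PinnedAtLive jc sh cr` replaced by «pinned to `crGap₁₃V 2 (jc …) ρ n` on the live line, to
`crOneTerm₁₃ 0` off it»): from N20's and N19′'s WITNESSES at the gapped objects on the live line + node U5's Target off it + (H-ζ) + the dial rows, there IS a spine reading so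
pinned carrying ALL FOUR K5 faces `KeyedRelWeight ∧ KeyedShellWeight ∧ KeyedExtractionV ∧ KeyedCoreEdgeHolderD4V β · rr` — N21's and N27x's by THEOREM.  The registered pin is
the plan's; this is the kernel form of the alternative, nothing more. [bookkeeping] -/
theorem exists_gapPinned_faces (β : ℝ) (rr : RateReadingFn) (jc : CutReading) (ρ : WidthLetter₁₃CoPH 2) (n : DepthLetter₁₃CoPH 2)
    (hζm : ∀ (F : T4Family) (θ : Stage13HParams F 2), θ.Provisos₁₃CoPH F 2 → ((θ.ZhUnity F 2 ∧ θ.SlotsNondegenerate₁₃ F 2) ∧ LiveSel F θ) → θ.Admissible F 2 →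
      ZetaMeasurable F 2 θ.ζ)
    (hρ : ∀ (F : T4Family) (θ : Stage13HParams F 2) (hP : θ.Provisos₁₃CoPH F 2) (g₀ : ℕ → ℝ) (os : List (ULoop F)) (K : ℕ),
      0 ≤ ρ F θ hP g₀ os K ∧ ρ F θ hP g₀ os K ≤ 1)
    (hn : ∀ (F : T4Family) (θ : Stage13HParams F 2) (hP : θ.Provisos₁₃CoPH F 2) (g₀ : ℕ → ℝ) (os : List (ULoop F)),
      Summable (fun K => 1 / ((n F θ hP g₀ os K : ℝ) + 1)))
    (h20 : ∀ (F : T4Family) (θ : Stage13HParams F 2) (hP : θ.Provisos₁₃CoPH F 2), ((θ.ZhUnity F 2 ∧ θ.SlotsNondegenerate₁₃ F 2) ∧ LiveSel F θ) → θ.Admissible F 2 →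
      ∀ (g₀ : ℕ → ℝ) (os : List (ULoop F)),
        ∃ W : ℕ → ℝ, RelWeightBound 1 (classSet₁₃ θ 0 g₀) (gapWeightA₁₃ θ hP 0 g₀ os (ρ F θ hP g₀ os) (n F θ hP g₀ os))
          (gapWeightB₁₃ θ hP 0 g₀ os (ρ F θ hP g₀ os) (n F θ hP g₀ os)) (badClass₁₃ θ 0 g₀ (jc F θ hP g₀ os)) W)
    (h19 : ∀ (F : T4Family) (θ : Stage13HParams F 2) (h : θ.Provisos₁₃SepCoPH F 2) (v : Revision₁₃ F 2 θ h),
      ((θ.ZhUnity F 2 ∧ θ.SlotsNondegenerate₁₃ F 2) ∧ LiveSel F θ) → θ.Admissible F 2 →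
      B16.EndStatementBPrinted (datumOfRecord₁₃SepCoPHV F 2 θ h v).C → DagBinding.EndpointExistence (datumOfRecord₁₃SepCoPHV F 2 θ h v).C.toB12 →
        ForSmallCouplings (datumOfRecord₁₃SepCoPHV F 2 θ h v) fun g₀ => ∀ os : List (ULoop F),
          PHolderD4 β (datumOfRecord₁₃SepCoPHV F 2 θ h v) (rr F θ h.toCore g₀ os) →
            letI : DecidableEq (Σ K, SiteSeqKey F (0 + K)) := Classical.decEq _
            ∃ δ : ℕ → ℝ, NE7.Core 1 (F.side ^ 4) (classSet₁₃ θ 0 g₀) (badClass₁₃ θ 0 g₀ (jc F θ h.toCore g₀ os))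
              (gapCoreA₁₃ θ h.toCore 0 g₀ os (ρ F θ h.toCore g₀ os) (n F θ h.toCore g₀ os))
              (gapCoreB₁₃ θ h.toCore 0 g₀ os (ρ F θ h.toCore g₀ os) (n F θ h.toCore g₀ os)) δ ∧ Summable δ)
    (htarget : ∀ (F : T4Family) (θ : Stage13HParams F 2) (hP : θ.Provisos₁₃CoPH F 2), ((θ.ZhUnity F 2 ∧ θ.SlotsNondegenerate₁₃ F 2) ∧ ¬ LiveSel F θ) → θ.Admissible F 2 →
      ∀ (g₀ : ℕ → ℝ) (os : List (ULoop F)), PHolderD4 β (datumOfRecord₁₃CoPH F 2 θ hP) (rr F θ hP g₀ os) →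
        ∃ δ : ℕ → ℝ, NE7.Target ((F.side : ℝ) ^ 4) 1 δ (fun K => T4GenFunBounds.schemeZ ((datumOfRecord₁₃CoPH F 2 θ hP).scheme g₀) os (0 + K))) :
    ∃ cr : SpineReading,
      (∀ (F : T4Family) (θ : Stage13HParams F 2) (hP : θ.Provisos₁₃CoPH F 2) (g₀ : ℕ → ℝ) (os : List (ULoop F)),
        LiveSel F θ → cr F θ hP g₀ os = crGap₁₃V 2 (jc F θ hP g₀ os) ρ n F θ hP g₀ os) ∧
      (∀ (F : T4Family) (θ : Stage13HParams F 2) (hP : θ.Provisos₁₃CoPH F 2) (g₀ : ℕ → ℝ) (os : List (ULoop F)),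
        ¬ LiveSel F θ → cr F θ hP g₀ os = crOneTerm₁₃ 0 F θ hP g₀ os) ∧
      KeyedRelWeight cr ∧ KeyedShellWeight cr ∧ KeyedExtractionV cr ∧ KeyedCoreEdgeHolderD4V β cr rr := by
  obtain ⟨cr, hon, hoff⟩ := exists_reading_livePin (fun F θ hP g₀ os => crGap₁₃V 2 (jc F θ hP g₀ os) ρ n F θ hP g₀ os)
  exact ⟨cr, hon, hoff, keyedRelWeight_of_gapPin_of_witness jc ρ n hon hoff h20, keyedShellWeight_of_gapPin jc ρ n hon hoff hζm hρ hn,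
    keyedExtractionV_of_gapPin jc ρ n hon hoff hζm, keyedCoreEdgeHolderD4V_of_gapPin_of_witness jc ρ n hon hoff hζm β rr hρ hn h19 htarget⟩

end GapRoad

end Summit.QuantumFields.YangMills.Theorems.N21GappedRoadK3V6Knit

end
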